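import Literature.NumberTheory.Automorphic.AutomorphicRepsGLCuspidalL2Step1Garding
import Literature.NumberTheory.Automorphic.AutomorphicRepsGLCuspidalL2Step1Bump
import HarnessLib

/-!
# Step 1 of Borel–Jacquet 4.6 for `GL_n` from the named literature facts
(assembly of `AutomorphicRepsGL.formsOfL2_ne_bot`)

Topic `NumberTheory/Automorphic`. The named fact `AutomorphicRepsGL.formsOfL2_ne_bot hcpt μ` of
`AutomorphicRepsGLCuspidalL2` (Borel–Jacquet (1979), 4.6, Step 1: an irreducible closed invariant
`Π ≤ L²_cusp(GL_n(K) A_G \ GL_n(𝔸_K))` contains a non-zero automorphic form) was decomposed in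
`AutomorphicRepsGLCuspidalL2Step1` into F1a (a non-zero `K_∞`-finite Gårding-fixed vector), F1b
(Gårding smoothness of smoothed `L²`-forms), the basic estimate `(9.13)` and F1d (infinitesimal
character on Gårding vectors), with the assembly `AutomorphicRepsGL.formsOfL2_ne_bot_of` proved
there. Since then

* F1b is PROVED (`AutomorphicRepsGL.isArchSmooth_smoothedForm_holds`,
  `AutomorphicRepsGLCuspidalL2Step1Garding`: differentiation under the integral sign, test
  functions as finite sums of pure tensors);
* F1a is PROVED from the basic estimate, reduction theory and unimodularity
  (`AutomorphicRepsGL.exists_kFinite_garding_fixed_of'`, `AutomorphicRepsGLCuspidalL2Step1KFinite`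
  and `AutomorphicRepsGLCuspidalL2Step1Bump`: compact self-adjoint smoothing operators, Bump (1997),
  proof of Thm. 3.2.3, with the `Ad K_∞`-invariant symmetric bumps constructed explicitly).

This file records the resulting assembly `AutomorphicRepsGL.formsOfL2_ne_bot_of_facts`:
**`formsOfL2_ne_bot` follows from four named literature facts**, each a theorem in print —

1. `GLnCuspidalSpectrum.norm_smoothedForm_le_of_isSiegelSetGL n K μ` (the basic estimate for
   smoothed cusp forms on a Siegel set; Garrett (2018), Thm. 7.3.10, Getz–Hahn (2024),
   Prop. 9.6.1 / (9.13));
2. `reductionTheory_gl n K` (reduction theory for `GL_n`; Getz–Hahn (2024), Thm. 2.7.2);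
3. `GLn.isMulRightInvariant_of_isHaarMeasure_adelic n K` (`GL_n(𝔸_K)` is unimodular; Getz–Hahn
   (2024), Lemma 3.5.4);
4. `AutomorphicRepsGL.exists_infinitesimalCharacter_garding hcpt μ` (F1d: `Z(𝔤)` acts by a
   character on the Gårding vectors of an irreducible `Π`; Segal–Mautner, Knapp–Vogan (1995),
   Thm. 0.2; Getz–Hahn (2024), proof of Thm. 6.5.1, printed p. 192).

No new definition, no new named fact; everything here is proved.

## References

* A. Borel, H. Jacquet, *Automorphic forms and automorphic representations*, Proc. Sympos. Pure
  Math. 33 (1979), part 1, §4.6 [BorelJacquet1979].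
* D. Bump, *Automorphic Forms and Representations* (1997), proofs of Thm. 3.2.2–3.2.3
  (PDF pp. 280–281) [Bump1997].
* J. R. Getz, H. Hahn, *An Introduction to Automorphic Representations*, GTM 300 (2024),
  Prop. 4.2.3, Lemma 9.8.2, proof of Thm. 6.5.1 (printed p. 192) [GetzHahn2024].
-/

open scoped MatrixGroups
open NumberField
open _root_.MeasureTheory

noncomputable section

namespace Literature.NumberTheory.Automorphic

variable {n : ℕ} {K : Type} [Field K] [NumberField K]
  {hcpt : isCompact_glFiniteIntegralLevel n K}
  {μ : Measure (AdelicGroupData.gl n K).automorphicQuotient}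
  [(AdelicGroupData.gl n K).IsAutomorphicMeasure μ]

/-- **Step 1 of Borel–Jacquet 4.6 for `GL_n` from the named literature facts.** An irreducible
closed invariant `Π ≤ L²_cusp(GL_n(K) A_G \ GL_n(𝔸_K), μ)` contains a non-zero automorphic form
(`AutomorphicRepsGL.formsOfL2_ne_bot hcpt μ`), granted (1) the basic estimate for smoothed cusp
forms on a Siegel set, (2) reduction theory for `GL_n`, (3) unimodularity of `GL_n(𝔸_K)` and
(4) the infinitesimal character of `Z(𝔤)` on Gårding vectors (F1d): F1a is
`AutomorphicRepsGL.exists_kFinite_garding_fixed_of'` (from (1)–(3)), F1b is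
`AutomorphicRepsGL.isArchSmooth_smoothedForm_holds`, and `AutomorphicRepsGL.formsOfL2_ne_bot_of`
assembles. Borel–Jacquet (1979), 4.6; Bump (1997), proof of Thm. 3.2.2 (PDF p. 280); Getz–Hahn
(2024), proof of Thm. 6.5.1 (printed p. 192). [cite: BorelJacquet1979, §4.6] -/
theorem AutomorphicRepsGL.formsOfL2_ne_bot_of_facts
    (hBE : GLnCuspidalSpectrum.norm_smoothedForm_le_of_isSiegelSetGL n K μ)
    (hRT : reductionTheory_gl n K) (hU1 : GLn.isMulRightInvariant_of_isHaarMeasure_adelic n K)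
    (h₄ : AutomorphicRepsGL.exists_infinitesimalCharacter_garding hcpt μ) :
    AutomorphicRepsGL.formsOfL2_ne_bot hcpt μ :=
  AutomorphicRepsGL.formsOfL2_ne_bot_of hcpt μ
    (AutomorphicRepsGL.exists_kFinite_garding_fixed_of' n K hBE hRT hU1)
    (AutomorphicRepsGL.isArchSmooth_smoothedForm_holds hcpt μ) hBE hRT h₄

end Literature.NumberTheory.Automorphic
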